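import Literature.Claims.NS.ClayVariants
import Literature.Analysis.FluidPDE.NSVorticityBKMMaximal
import HarnessLib

/-!
# Claim C88 `Rockwell2025` — global regularity «via Hodge theory and weighted Sobolev decay» (typed, nothing asserted)

M. Rockwell, *Existence and Smoothness of Three-Dimensional Navier-Stokes Solutions via Hodge Theory
and Weighted Sobolev Decay*, MPRA Paper 127103 (2025) = Authorea
doi:10.22541/au.176391556.62349900/v1 [cite: Rockwell2025NSHodge]. NS-CLAIMS sweep D-0090, row C88
(T3 tranche), typist ns-claims-typist-11 g2; sources `run/shared/lean/pub/ns-claims/sources/Rockwell2025/`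
(PDF + `text/`, PDF page k = print page k − 1; «p.» below = PRINT page; LOCATORS.md by ns-claims-lit-1).

WHAT IS CLAIMED. Theorem 8.1 (p.17–18): for `u° ∈ C^∞(ℝ³)`, `δu° = 0`, `|∂^α u°(x)| ≤ C_{αK}(1+|x|)^{−K}`
for all `α` with `K > 5` (77), and forces with `|∂^α_x∂^m_t f| ≤ C(1+|x|+t)^{−K}` (78), «there exists a
unique solution (u, p) to (8)–(10) with u ∈ C^∞(ℝ³ × [0,∞)), p ∈ C^∞(ℝ³ × (0,∞)), ∫|u(x,t)|² dx < C for
all t ≥ 0»; Theorem 9.1 (p.18) «verification of (A)»; abstract p.1 «taking the forcing term identically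
zero … This closes the gap in the Beale-Kato-Majda conditional regularity criterion». (8)–(10) (p.6,
Thm 3.4) = the Navier–Stokes system written on 1-forms (`D_t u = −νΔu − dp + f`, Hodge sign, `δu = 0`,
`u|_{t=0} = u°`), equivalent to (1)–(3).

PRINTED COMPOSITION (p.18 Steps 1–7; §7.6 p.17 «Closing the Loop»): weak existence (Thm 5.1 p.7–8:
«Standard Galerkin approximation methods … establish existence», 5 lines) → **Thm 7.3 (p.13) BKM-type
condition from decay: data (50) = (77) with `K > 5` ⇒ `∫₀^∞ ‖∇u(·,s)‖_∞ ds < ∞` (51)**, proved on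
pp.14–16 by: Lemma 7.4 weighted Sobolev embedding ⇒ (56) `‖∇u(·,t)‖_∞ ≤ C N_K(t)^{1/2}`, where (54)
`N_K(t) := Σ_{|α|≤3} ∫ (1+|x|)^{2K} |∂^α u(Φ_t(x), t)|² dx` is the weighted energy TRANSPORTED by the flow
map `Φ_t` of `u` (53); (55)/(57) transport + Grönwall; **Lemma 7.5 (p.15) weighted energy decay (58)
`N_K(t) ≤ C N_K(0)/(1+t)^{K−3}`**, whose proof compares with the linear weighted heat equation (59)–(61)
(«formally», (60) «∂_t v = νΔv + lower order terms + nonlinear terms») and asserts **(62)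
`‖w(·,t)‖²_{L²} ≤ C‖w(·,0)‖²_{L²}/(1+t)^{K−3}` for the HEAT flow `∂_t w = νΔw`, `w(·,0) = (1+|x|)^K u°`**
(«weighted heat kernel estimates (cf. Escobedo–Zuazua, Thm 2.2) … combined with the moment
∫|x|^{2K}|u°|² dx < ∞»), then (64)–(65) Grönwall with the unestimated «nonlinear terms», Step 4c (66)–(68)
(«the sought decay N_K(t) ∼ (1+t)^{−(K−3)} implies …») ⇒ (69) `‖∇u(·,t)‖_∞ ≤ C/(1+t)^{(K−4)/2}` ⇒ (70)
`∫₀^∞ ds/(1+s)^{(K−4)/2} < ∞` («Since (K−4)/2 > 1/2 for K > 5, and in fact (K−4)/2 > 1 for K > 6») → Cor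
7.6 (p.17) global `H^k` bound (74) via Lemma 6.1 + Grönwall → Sobolev ⇒ `C^∞` → pressure (Lemma 6.5) →
energy.

HOW IT IS TYPED. `ClaimedTheorem` = Theorem 8.1/9.1 in the unforced case `f ≡ 0` (the Clay-relevant case
the abstract singles out; the forced variant only widens it), data class `IsDecayDatum K` = (77), solution
= the tree's `IsClassicalNSSolutionOn (Ici 0) ν 0 u p` with `u 0 = u°` and `HasBoundedEnergy u` (Thm 9.1's
(A)-reading: `p` smooth on the CLOSED half-line, as (A) demands and Thm 9.1 asserts; Thm 8.1 item 2 prints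
the open interval — recorded); `clay_of_claimed : ClaimedTheorem → ClayVariants.clayR3.Regularity` is
PROVED (Clay data (4) satisfy (77) for every `K`), so there is NO wrong-problem axis. The a-priori chain
of Thm 7.3 is typed display by display, as Props about every classical solution on a slab `[0,T)` issued
from a datum of the class: `Step_56`, `Step_58` (Lemma 7.5), `Step_62` (the heat-equation claim, typed
over classical heat flows with finite-energy datum — only `‖w(·,0)‖_{L²}` enters the display), `Step_69`,
`Step_70` (the elementary integral, literally), `Step_51` (Thm 7.3 as an a-priori integrable majorant of
`‖∇u(t)‖_∞` depending on the datum only), `Step_flow` (IMPLICIT: the flow map (53) exists on the slab),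
`Step_cont` (the classical wrapper Thm 5.1 + Cor 7.6 + Steps 3–6 p.18: an a-priori `L¹_t Lip_x` bound for
all classical solutions from `u°` yields the global smooth bounded-energy solution — BKM-type
continuation, classical, not attacked here); kernel relations `step69_of_steps : Step_flow → Step_56 →
Step_58 → Step_69`, `step51_of_69_70 : Step_69 → Step_70 → Step_51`, `claim_of_steps : Step_cont →
Step_51 → ClaimedTheorem`. NOTHING of the paper is asserted. For the refuter/referee (recorded, not
adjudicated here): (i) (62) is a statement about the free heat flow — for `w₀ ∈ L¹ ∩ L²` with
`∫w₀ ≠ 0`, `‖e^{νtΔ}w₀‖²_{L²} ∼ |∫w₀|² (8πνt)^{−3/2}`, slower than `(1+t)^{−(K−3)}` for every `K > 9/2`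
(generic `(1+|x|)^K u°` with `u°` Schwartz and divergence-free has non-zero mean); with a universal `C`
it also fails by dilating the datum; (ii) (70) is false arithmetic for `5 < K ≤ 6` (exponent
`(K−4)/2 ≤ 1`; kernel face `not_integrableOn_one_add_rpow_of_le` below); (iii) Step 4c (66) uses «the
sought decay» to bound the exponential factor of (65) (circular without a smallness/bootstrap argument);
(iv) (60)/(64) «nonlinear terms» (pressure is non-local) are never estimated.

WHAT THIS IS NOT: not a claim about NS regularity or blow-up; not a claim about any author beyond the
typed locator.
-/

noncomputable section

open Set Function Filter MeasureTheory
open scoped Topology ENNReal NNReal ContDiff Laplacian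

namespace Literature.Claims.NS.Rockwell2025

open Literature.Analysis.FluidPDE

/-! ### Vocabulary (pp.13–18) -/

/-- The DATA CLASS (77) p.17 (= (50) p.13): `u° ∈ C^∞`, `δu° = 0` (divergence-free, Prop 3.3(1) p.6),
`|∂^α u°(x)| ≤ C_{αK}(1+|x|)^{−K}` for every `α`, for the given real `K` (full `n`-th Fréchet
derivative in place of the partials, as in the tree's `HasRapidSpatialDecay`).
[cite: Rockwell2025NSHodge, Theorem 8.1 (77) p.17] -/
def IsDecayDatum (K : ℝ) (u₀ : EuclideanSpace ℝ (Fin 3) → EuclideanSpace ℝ (Fin 3)) : Prop :=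
  ContDiff ℝ ∞ u₀ ∧ NSWave0.IsDivFree u₀ ∧
    ∀ n : ℕ, ∃ C : ℝ, ∀ x, (1 + ‖x‖) ^ K * ‖iteratedFDeriv ℝ n u₀ x‖ ≤ C

/-- **Theorem 8.1 / 9.1 (pp.17–18), unforced case, in the (A)-reading of Thm 9.1**: for every `ν > 0`,
every `K > 5` and every datum of class (77) there are `u`, `p` smooth on `ℝ³ × [0,∞)` solving (8)–(10)
(= (1)–(3), Thm 3.4 p.6) with `f ≡ 0`, `u(0) = u°`, and bounded energy. (Thm 8.1 item 2 prints
`p ∈ C^∞(ℝ³ × (0,∞))`; Thm 9.1 claims (A), whose pressure is smooth on the closed half-line — typed so;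
uniqueness, also printed, is not typed.) [cite: Rockwell2025NSHodge, Theorem 8.1 pp.17–18; Theorem 9.1 p.18] -/
def ClaimedTheorem : Prop :=
  ∀ ν : ℝ, 0 < ν → ∀ K : ℝ, 5 < K →
    ∀ u₀ : EuclideanSpace ℝ (Fin 3) → EuclideanSpace ℝ (Fin 3), IsDecayDatum K u₀ →
      ∃ (u : ℝ → EuclideanSpace ℝ (Fin 3) → EuclideanSpace ℝ (Fin 3))
        (p : ℝ → EuclideanSpace ℝ (Fin 3) → ℝ),
        IsClassicalNSSolutionOn (Ici 0) ν 0 u p ∧ u 0 = u₀ ∧ HasBoundedEnergy u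

/-- A FLOW MAP of `u` on the slab `[0,T)` ((53) p.14, (71) p.16): `Φ₀ = id`,
`d/dt Φ_t(x) = u(Φ_t(x), t)` (one-sided within the slab). [cite: Rockwell2025NSHodge, (53) p.14] -/
def IsFlowMap (T : ℝ) (u : ℝ → EuclideanSpace ℝ (Fin 3) → EuclideanSpace ℝ (Fin 3))
    (Φ : ℝ → EuclideanSpace ℝ (Fin 3) → EuclideanSpace ℝ (Fin 3)) : Prop :=
  (∀ x, Φ 0 x = x) ∧ ∀ x, ∀ t ∈ Ico 0 T, HasDerivWithinAt (fun s => Φ s x) (u t (Φ t x)) (Ico 0 T) t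

/-- The TRANSPORTED WEIGHTED ENERGY (54) p.14 (= (72) p.16):
`N_K(t) = Σ_{|α|≤3} ∫ (1+|x|)^{2K} |∂^α u(Φ_t(x), t)|² dx` (Fréchet derivatives of order `≤ 3` in place
of the partials; Bochner integral, `0` if divergent). [cite: Rockwell2025NSHodge, (54) p.14] -/
def weightedEnergy (K : ℝ) (u : ℝ → EuclideanSpace ℝ (Fin 3) → EuclideanSpace ℝ (Fin 3))
    (Φ : ℝ → EuclideanSpace ℝ (Fin 3) → EuclideanSpace ℝ (Fin 3)) (t : ℝ) : ℝ :=
  ∫ x, (1 + ‖x‖) ^ (2 * K) * ∑ n ∈ Finset.range 4, ‖iteratedFDeriv ℝ n (u t) (Φ t x)‖ ^ 2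

/-! ### The typed steps of the a-priori chain (Thm 7.3, pp.13–16) -/

/-- **IMPLICIT step (53) p.14**: every classical solution on `[0,T)` issued from a datum of the class has
a flow map on the slab (classical for bounded smooth velocities; boundedness is not established at this
point of the text). [cite: Rockwell2025NSHodge, (53) p.14] -/
def Step_flow : Prop :=
  ∀ ν : ℝ, 0 < ν → ∀ K : ℝ, 5 < K → ∀ u₀, IsDecayDatum K u₀ →
    ∀ (T : ℝ) (u : ℝ → EuclideanSpace ℝ (Fin 3) → EuclideanSpace ℝ (Fin 3))
      (p : ℝ → EuclideanSpace ℝ (Fin 3) → ℝ),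
      IsClassicalNSSolutionOn (Ico 0 T) ν 0 u p → u 0 = u₀ → ∃ Φ, IsFlowMap T u Φ

/-- **(56) p.14** (Lemma 7.4 applied to `∇u`): `‖∇u(·,t)‖_∞ ≤ C N_K(t)^{1/2}` with `C = C(K)`.
[cite: Rockwell2025NSHodge, (56) p.14; Lemma 7.4 p.14] -/
def Step_56 : Prop :=
  ∀ K : ℝ, 5 < K → ∃ C : ℝ, ∀ ν : ℝ, 0 < ν → ∀ u₀, IsDecayDatum K u₀ →
    ∀ (T : ℝ) (u : ℝ → EuclideanSpace ℝ (Fin 3) → EuclideanSpace ℝ (Fin 3))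
      (p : ℝ → EuclideanSpace ℝ (Fin 3) → ℝ), IsClassicalNSSolutionOn (Ico 0 T) ν 0 u p → u 0 = u₀ →
      ∀ Φ, IsFlowMap T u Φ → ∀ t ∈ Ico 0 T, ∀ x,
        ‖fderiv ℝ (u t) x‖ ≤ C * Real.sqrt (weightedEnergy K u Φ t)

/-- **Lemma 7.5 (58) p.15 — weighted energy decay (LOAD-BEARING candidate)**:
`N_K(t) ≤ C N_K(0)/(1+t)^{K−3}` for every solution from a datum of the class, `C = C(ν, K)` (the print's
bare «C»; the lemma's data hypothesis `u° ∈ W^{k,2}_K` is narrowed to the theorem's class (77) —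
charitable). Its printed proof is (59)–(68): see `Step_62` and the module docstring (i)–(iv).
[cite: Rockwell2025NSHodge, Lemma 7.5 (58) p.15] -/
def Step_58 : Prop :=
  ∀ ν : ℝ, 0 < ν → ∀ K : ℝ, 5 < K → ∃ C : ℝ, ∀ u₀, IsDecayDatum K u₀ →
    ∀ (T : ℝ) (u : ℝ → EuclideanSpace ℝ (Fin 3) → EuclideanSpace ℝ (Fin 3))
      (p : ℝ → EuclideanSpace ℝ (Fin 3) → ℝ), IsClassicalNSSolutionOn (Ico 0 T) ν 0 u p → u 0 = u₀ →
      ∀ Φ, IsFlowMap T u Φ → ∀ t ∈ Ico 0 T,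
        weightedEnergy K u Φ t ≤ C * weightedEnergy K u Φ 0 / (1 + t) ^ (K - 3)

/-- **Lemma 7.5 (58) at its PRINTED data class** (referee ns-claims-ref-4 g2, RETYPE F3): the lemma is
stated for `u° ∈ W^{k,2}_K`, i.e. with the weighted energy FINITE at `t = 0` — which the pointwise
class (77) alone does not give (`(1+|x|)^{2K}·|∂^α u°|² ≲ 1` is not integrable). Typed with both (77)
and the integrability of the `t = 0` integrand (more hypotheses than either printed class: charitable),
so that no conclusion can be drawn from the Bochner junk value. `Step_58 → Step_58W`.
[cite: Rockwell2025NSHodge, Lemma 7.5 (58) p.15] -/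
def Step_58W : Prop :=
  ∀ ν : ℝ, 0 < ν → ∀ K : ℝ, 5 < K → ∃ C : ℝ, ∀ u₀, IsDecayDatum K u₀ →
    Integrable (fun x : EuclideanSpace ℝ (Fin 3) =>
      (1 + ‖x‖) ^ (2 * K) * ∑ n ∈ Finset.range 4, ‖iteratedFDeriv ℝ n u₀ x‖ ^ 2) →
    ∀ (T : ℝ) (u : ℝ → EuclideanSpace ℝ (Fin 3) → EuclideanSpace ℝ (Fin 3))
      (p : ℝ → EuclideanSpace ℝ (Fin 3) → ℝ), IsClassicalNSSolutionOn (Ico 0 T) ν 0 u p → u 0 = u₀ →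
      ∀ Φ, IsFlowMap T u Φ → ∀ t ∈ Ico 0 T,
        weightedEnergy K u Φ t ≤ C * weightedEnergy K u Φ 0 / (1 + t) ^ (K - 3)

/-- `Step_58 → Step_58W` (the printed-class version has more hypotheses).
[cite: Rockwell2025NSHodge, Lemma 7.5 (58) p.15] -/
theorem step58W_of_58 (h : Step_58) : Step_58W := by
  intro ν hν K hK
  obtain ⟨C, hC⟩ := h ν hν K hK
  exact ⟨C, fun u₀ hu₀ _ T u p hsol h0 Φ hΦ t ht => hC u₀ hu₀ T u p hsol h0 Φ hΦ t ht⟩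

/-- **(62) p.15 — the heat-equation claim inside Lemma 7.5's proof**: for the linear heat flow
`∂_t w = νΔw` on `ℝ³ × [0,∞)` (61) with finite-energy datum («w(x,0) = (1+|x|)^K u°(x)»; only
`‖w(·,0)‖_{L²}` enters the display, the invoked moment `∫|x|^{2K}|u°|² < ∞` being `‖w(·,0)‖²_{L²} < ∞`
up to the bounded factor `(|x|/(1+|x|))^{2K}`): `‖w(·,t)‖²_{L²} ≤ C‖w(·,0)‖²_{L²}/(1+t)^{K−3}`,
`C = C(ν, K)`. Typed over jointly smooth classical heat flows with square-integrable datum (energies as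
lower Lebesgue integrals). [cite: Rockwell2025NSHodge, (61)–(62) p.15] -/
def Step_62 : Prop :=
  ∀ ν : ℝ, 0 < ν → ∀ K : ℝ, 5 < K → ∃ C : ℝ, 0 ≤ C ∧
    ∀ w : ℝ → EuclideanSpace ℝ (Fin 3) → EuclideanSpace ℝ (Fin 3), IsSmoothSpaceTimeOn (Ici 0) w →
      (∀ t ∈ Ici (0 : ℝ), ∀ x, timeDerivWithin (Ici 0) w t x = ν • (Δ (w t)) x) →
      (∫⁻ x, ‖w 0 x‖ₑ ^ 2) < (⊤ : ℝ≥0∞) →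
      ∀ t : ℝ, 0 ≤ t →
        (∫⁻ x, ‖w t x‖ₑ ^ 2) ≤ ENNReal.ofReal (C / (1 + t) ^ (K - 3)) * ∫⁻ x, ‖w 0 x‖ₑ ^ 2

/-- **(69) p.16** (closing of Thm 7.3's proof): `‖∇u(·,t)‖_∞ ≤ C/(1+t)^{(K−4)/2}` for every classical
solution from the datum, `C` depending on `ν`, `K`, `u°` only. [cite: Rockwell2025NSHodge, (69) p.16] -/
def Step_69 : Prop :=
  ∀ ν : ℝ, 0 < ν → ∀ K : ℝ, 5 < K → ∀ u₀, IsDecayDatum K u₀ → ∃ C : ℝ,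
    ∀ (T : ℝ) (u : ℝ → EuclideanSpace ℝ (Fin 3) → EuclideanSpace ℝ (Fin 3))
      (p : ℝ → EuclideanSpace ℝ (Fin 3) → ℝ), IsClassicalNSSolutionOn (Ico 0 T) ν 0 u p → u 0 = u₀ →
      ∀ t ∈ Ico 0 T, ∀ x, ‖fderiv ℝ (u t) x‖ ≤ C / (1 + t) ^ ((K - 4) / 2)

/-- **(70) p.16, literally**: «Since (K − 4)/2 > 1/2 for K > 5 …: ∫₀^∞ ds/(1+s)^{(K−4)/2} < ∞» — for
every `K > 5`. (False arithmetic for `5 < K ≤ 6`, where the exponent is `≤ 1`: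
`not_integrableOn_one_add_rpow_of_le`; the text itself adds «in fact (K − 4)/2 > 1 for K > 6».)
[cite: Rockwell2025NSHodge, (70) p.16] -/
def Step_70 : Prop :=
  ∀ K : ℝ, 5 < K → IntegrableOn (fun s : ℝ => ((1 + s) ^ ((K - 4) / 2))⁻¹) (Ioi 0)

/-- **Theorem 7.3 (51) p.13 as the a-priori statement it is used as (p.18 Step 2)**: for every datum of
the class there is an integrable majorant `g` on `(0,∞)`, depending on `ν`, `K`, `u°` only, of
`‖∇u(·,t)‖_∞` for every classical solution on every slab `[0,T)` issued from `u°` — hence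
`∫₀^T ‖∇u‖_∞ ≤ ∫g < ∞` uniformly in `T`. [cite: Rockwell2025NSHodge, Theorem 7.3 (51) p.13] -/
def Step_51 : Prop :=
  ∀ ν : ℝ, 0 < ν → ∀ K : ℝ, 5 < K → ∀ u₀, IsDecayDatum K u₀ → ∃ g : ℝ → ℝ, IntegrableOn g (Ioi 0) ∧
    ∀ (T : ℝ) (u : ℝ → EuclideanSpace ℝ (Fin 3) → EuclideanSpace ℝ (Fin 3))
      (p : ℝ → EuclideanSpace ℝ (Fin 3) → ℝ), IsClassicalNSSolutionOn (Ico 0 T) ν 0 u p → u 0 = u₀ →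
      ∀ t ∈ Ico 0 T, ∀ x, ‖fderiv ℝ (u t) x‖ ≤ g t

/-- **The classical wrapper (Thm 5.1 p.7–8 + Cor 7.6 p.17 + Steps 1, 3–6 p.18)**: an a-priori integrable
majorant of `‖∇u(·,t)‖_∞` valid for every classical solution from `u°` yields a global smooth solution
with bounded energy (local existence + BKM-type continuation for Navier–Stokes + energy inequality;
classical, not attacked — Thm 5.1's own five-line proof («appropriate bounds», «standard Galerkin») and
the a-priori-vs-weak glue p.18 Step 1→2 are recorded in LOCATORS L1/L6).
[cite: Rockwell2025NSHodge, Theorem 5.1 pp.7–8; Corollary 7.6 p.17; proof of Theorem 8.1 p.18] -/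
def Step_cont : Prop :=
  ∀ ν : ℝ, 0 < ν → ∀ K : ℝ, 5 < K → ∀ u₀, IsDecayDatum K u₀ →
    (∃ g : ℝ → ℝ, IntegrableOn g (Ioi 0) ∧
      ∀ (T : ℝ) (u : ℝ → EuclideanSpace ℝ (Fin 3) → EuclideanSpace ℝ (Fin 3))
        (p : ℝ → EuclideanSpace ℝ (Fin 3) → ℝ), IsClassicalNSSolutionOn (Ico 0 T) ν 0 u p → u 0 = u₀ →
        ∀ t ∈ Ico 0 T, ∀ x, ‖fderiv ℝ (u t) x‖ ≤ g t) →
    ∃ (u : ℝ → EuclideanSpace ℝ (Fin 3) → EuclideanSpace ℝ (Fin 3))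
      (p : ℝ → EuclideanSpace ℝ (Fin 3) → ℝ),
      IsClassicalNSSolutionOn (Ici 0) ν 0 u p ∧ u 0 = u₀ ∧ HasBoundedEnergy u

/-! ### Kernel relations (pure logic / arithmetic; nothing about the paper asserted) -/

/-- COMPOSITION p.18: the wrapper and Thm 7.3 give Theorem 8.1/9.1 (unforced).
[cite: Rockwell2025NSHodge, proof of Theorem 8.1 p.18] -/
theorem claim_of_steps (hc : Step_cont) (h51 : Step_51) : ClaimedTheorem :=
  fun ν hν K hK u₀ hu₀ => hc ν hν K hK u₀ hu₀ (h51 ν hν K hK u₀ hu₀)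

/-- (69) ∧ (70) ⇒ (51): the majorant `g(t) = C/(1+t)^{(K−4)/2}` is integrable on `(0,∞)` by (70).
[cite: Rockwell2025NSHodge, (69)–(70) p.16] -/
theorem step51_of_69_70 (h69 : Step_69) (h70 : Step_70) : Step_51 := by
  intro ν hν K hK u₀ hu₀
  obtain ⟨C, hC⟩ := h69 ν hν K hK u₀ hu₀
  refine ⟨fun t => C * ((1 + t) ^ ((K - 4) / 2))⁻¹, (h70 K hK).const_mul C, ?_⟩
  intro T u p hsol h0 t ht x
  have := hC T u p hsol h0 t ht x
  simpa [div_eq_mul_inv] using this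

/-- At `t = 0` the transported weighted energy depends on the datum only (`Φ₀ = id`).
[cite: Rockwell2025NSHodge, (53)–(54) p.14] -/
theorem weightedEnergy_zero {K T : ℝ} {u : ℝ → EuclideanSpace ℝ (Fin 3) → EuclideanSpace ℝ (Fin 3)}
    {Φ : ℝ → EuclideanSpace ℝ (Fin 3) → EuclideanSpace ℝ (Fin 3)} (hΦ : IsFlowMap T u Φ) :
    weightedEnergy K u Φ 0 =
      ∫ x, (1 + ‖x‖) ^ (2 * K) * ∑ n ∈ Finset.range 4, ‖iteratedFDeriv ℝ n (u 0) x‖ ^ 2 := by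
  unfold weightedEnergy
  refine integral_congr_ae (Eventually.of_forall fun x => ?_)
  simp only [hΦ.1 x]

/-- (53) ∧ (56) ∧ (58) ⇒ (69): `‖∇u(t)‖ ≤ C₁ (C₂ N_K(0))^{1/2} (1+t)^{−(K−3)/2} ≤ C/(1+t)^{(K−4)/2}` with
`C = C₁ √(C₂ N_K(0))` depending on the datum only, since `(1+t)^{(K−4)/2} ≤ (1+t)^{(K−3)/2}`… i.e. the
printed (66) ⇒ (69). [cite: Rockwell2025NSHodge, (56)–(58), (66)–(69) pp.14–16] -/
theorem step69_of_steps (hfl : Step_flow) (h56 : Step_56) (h58 : Step_58) : Step_69 := by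
  intro ν hν K hK u₀ hu₀
  obtain ⟨C₁, hC₁⟩ := h56 K hK
  obtain ⟨C₂, hC₂⟩ := h58 ν hν K hK
  set N₀ : ℝ := ∫ x, (1 + ‖x‖) ^ (2 * K) *
    ∑ n ∈ Finset.range 4, ‖iteratedFDeriv ℝ n u₀ x‖ ^ 2 with hN₀
  refine ⟨max 0 (C₁ * Real.sqrt (max 0 (C₂ * N₀))), fun T u p hsol h0 t ht x => ?_⟩
  obtain ⟨Φ, hΦ⟩ := hfl ν hν K hK u₀ hu₀ T u p hsol h0
  have h1 := hC₁ ν hν u₀ hu₀ T u p hsol h0 Φ hΦ t ht x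
  have h2 := hC₂ u₀ hu₀ T u p hsol h0 Φ hΦ t ht
  have hE0 : weightedEnergy K u Φ 0 = N₀ := by rw [weightedEnergy_zero hΦ, h0]
  rw [hE0] at h2
  have ht0 : 0 ≤ t := ht.1
  have hb : 1 ≤ 1 + t := by linarith
  have hpos : 0 < (1 + t) ^ (K - 3) := Real.rpow_pos_of_pos (by linarith) _
  have hpos' : 0 < (1 + t) ^ ((K - 4) / 2) := Real.rpow_pos_of_pos (by linarith) _
  -- `N_K(t) ≤ max 0 (C₂ N₀) / (1+t)^{K-3}`
  have h3 : weightedEnergy K u Φ t ≤ max 0 (C₂ * N₀) / (1 + t) ^ (K - 3) :=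
    h2.trans (div_le_div_of_nonneg_right (le_max_right _ _) hpos.le)
  -- square roots
  have h4 : Real.sqrt (weightedEnergy K u Φ t) ≤
      Real.sqrt (max 0 (C₂ * N₀)) * ((1 + t) ^ ((K - 3) / 2))⁻¹ := by
    refine (Real.sqrt_le_sqrt h3).trans ?_
    rw [Real.sqrt_div' _ hpos.le, Real.sqrt_eq_rpow ((1 + t) ^ (K - 3)), ← Real.rpow_mul (by linarith)]
    have : (K - 3) * (1 / 2 : ℝ) = (K - 3) / 2 := by ring
    rw [this, div_eq_mul_inv]
  -- compare the two rates: `(1+t)^{(K-4)/2} ≤ (1+t)^{(K-3)/2}`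
  have h5 : ((1 + t) ^ ((K - 3) / 2))⁻¹ ≤ ((1 + t) ^ ((K - 4) / 2))⁻¹ := by
    refine inv_anti₀ hpos' ?_
    exact Real.rpow_le_rpow_of_exponent_le hb (by linarith)
  by_cases hC : 0 ≤ C₁
  · calc ‖fderiv ℝ (u t) x‖ ≤ C₁ * Real.sqrt (weightedEnergy K u Φ t) := h1
      _ ≤ C₁ * (Real.sqrt (max 0 (C₂ * N₀)) * ((1 + t) ^ ((K - 4) / 2))⁻¹) := by
          refine mul_le_mul_of_nonneg_left (h4.trans ?_) hC
          exact mul_le_mul_of_nonneg_left h5 (Real.sqrt_nonneg _)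
      _ = C₁ * Real.sqrt (max 0 (C₂ * N₀)) / (1 + t) ^ ((K - 4) / 2) := by ring
      _ ≤ max 0 (C₁ * Real.sqrt (max 0 (C₂ * N₀))) / (1 + t) ^ ((K - 4) / 2) :=
          div_le_div_of_nonneg_right (le_max_right _ _) hpos'.le
  · have hneg : C₁ * Real.sqrt (weightedEnergy K u Φ t) ≤ 0 :=
      mul_nonpos_of_nonpos_of_nonneg (le_of_not_ge hC) (Real.sqrt_nonneg _)
    calc ‖fderiv ℝ (u t) x‖ ≤ 0 := h1.trans hneg
      _ ≤ max 0 (C₁ * Real.sqrt (max 0 (C₂ * N₀))) / (1 + t) ^ ((K - 4) / 2) :=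
          div_nonneg (le_max_left _ _) hpos'.le

/-- A Clay datum ((4): smooth, divergence-free, `|∂^α u°| ≤ C_{αK}(1+|x|)^{−K}` for ALL `K`) is a datum
of class (77) for every `K ≥ 0` (take the integer `⌈K⌉`). [cite: Rockwell2025NSHodge, Theorem 9.1 p.18] -/
theorem isDecayDatum_of_clay {K : ℝ} {u₀ : EuclideanSpace ℝ (Fin 3) → EuclideanSpace ℝ (Fin 3)}
    (hu₀ : ContDiff ℝ ∞ u₀) (hdiv : NSWave0.IsDivFree u₀) (hdec : HasRapidSpatialDecay u₀) :
    IsDecayDatum K u₀ := by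
  refine ⟨hu₀, hdiv, fun n => ?_⟩
  obtain ⟨C, hC⟩ := hdec n ⌈K⌉₊
  refine ⟨C, fun x => ?_⟩
  have hb : 1 ≤ 1 + ‖x‖ := by
    have := norm_nonneg x
    linarith
  have h1 : (1 + ‖x‖) ^ K ≤ (1 + ‖x‖) ^ ((⌈K⌉₊ : ℕ) : ℝ) :=
    Real.rpow_le_rpow_of_exponent_le hb (Nat.le_ceil K)
  rw [Real.rpow_natCast] at h1
  exact (mul_le_mul_of_nonneg_right h1 (norm_nonneg _)).trans (hC x)

/-- **Clay link: Theorem 8.1/9.1 (unforced) implies Clay (A)** (`ClayVariants.clayR3.Regularity`): a Clay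
datum is a (77)-datum with `K = 6 > 5` (`isDecayDatum_of_clay`), and the claimed solution is a
Clay-sense solution (bridge `isNavierStokesSolution_and_smooth_iff`). No wrong-problem axis.
[cite: Rockwell2025NSHodge, Theorem 9.1 p.18] -/
theorem clay_of_claimed (h : ClaimedTheorem) : ClayVariants.clayR3.Regularity := by
  intro ν hν u₀ hu₀ hdiv hdecay
  obtain ⟨u, p, hsol, h0, hE⟩ :=
    h ν hν 6 (by norm_num) u₀ (isDecayDatum_of_clay hu₀ hdiv hdecay)
  obtain ⟨hns, hsu, hsp⟩ :=
    (isNavierStokesSolution_and_smooth_iff (ν := ν) (f := 0) (u₀ := u₀) (u := u) (p := p)).2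
      ⟨hsol, h0⟩
  exact ⟨u, p, hsu, hsp, hns, hE⟩

/-- **Kernel face of (70)**: `s ↦ 1/(1+s)^a` is NOT integrable on `(0,∞)` when `a ≤ 1` (translate to
`∫₁^∞ u^{−a} du`, which diverges for `−a ≥ −1`: Mathlib `integrableOn_Ioi_rpow_iff`) — the elementary fact
the text itself concedes («in fact (K − 4)/2 > 1 for K > 6»). [cite: Rockwell2025NSHodge, (70) p.16] -/
theorem not_integrableOn_one_add_rpow_of_le {a : ℝ} (ha : a ≤ 1) :
    ¬ IntegrableOn (fun s : ℝ => ((1 + s) ^ a)⁻¹) (Ioi 0) := by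
  intro h
  have hmp : MeasurePreserving (fun s : ℝ => s + 1) volume volume :=
    measurePreserving_add_right volume 1
  have hme : MeasurableEmbedding (fun s : ℝ => s + 1) := measurableEmbedding_addRight 1
  have hpre : (fun s : ℝ => s + 1) ⁻¹' (Ioi 1) = Ioi 0 := by
    ext s
    simp
  have h2 : IntegrableOn (fun u : ℝ => (u ^ a)⁻¹) (Ioi 1) := by
    rw [← hmp.integrableOn_comp_preimage hme, hpre]
    refine h.congr_fun (fun s _ => ?_) measurableSet_Ioi
    simp [add_comm]
  have h3 : IntegrableOn (fun u : ℝ => u ^ (-a)) (Ioi 1) := by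
    refine h2.congr_fun (fun u hu => ?_) measurableSet_Ioi
    have hu0 : 0 ≤ u := zero_le_one.trans (le_of_lt hu)
    simp only [Real.rpow_neg hu0]
  have := (integrableOn_Ioi_rpow_iff zero_lt_one).mp h3
  linarith

/-! ### D-0026 in-file discharge of the classical wrapper `Step_cont` (append-only)

`Step_cont` — the classical continuation wrapper of the printed composition (Thm 5.1 + Cor 7.6 + Steps 1,
3–6 p.18: an a-priori integrable majorant of `‖∇u(·,t)‖_∞` valid for every classical solution from `u°`
yields a global smooth solution with bounded energy) — is TRUE, and is here discharged from the tree's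
maximal-solution theorem in the Beale–Kato–Majda class (`Literature.Analysis.FluidPDE.exists_global_bkmClass_or_blowup`,
`NSVorticityBKMMaximal.lean`: Majda–Bertozzi 2002 Thm. 3.4 / Cor. 3.1 / Cor. 3.2 / Thm. 3.6 and
Beale–Kato–Majda 1984, all proved in the tree): a (77)-datum with `K > 5` has all derivatives in `L²`
(`IsDecayDatum.lintegral_enorm_iteratedFDeriv_sq_lt_top`), so it launches a maximal BKM-class solution; on
the blow-up branch `∫₀^{T*} sup|curl u| = ∞`, which the integrable majorant forbids
(`|curl u| ≤ 4‖∇u‖ ≤ 4g`); on the global branch the energy bound is the tree's energy inequality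
`IsClassicalNSSolutionOn.bkm_energy_le` (Majda–Bertozzi Prop. 3.1). Nothing else in the file is touched: the
locator of record `Step_62` ((61)–(62) p.15, `…Theorems.Rockwell2025.not_Step_62`), `Step_70`
(`not_Step_70`), the class and the composition are unchanged. -/

/-- A datum of class (77) with `K > 3/2` — in particular every `K > 5` — has all derivatives in `L²(ℝ³)`:
`‖Dⁿu°(x)‖² ≤ C²(1+|x|)^{−2K}` pointwise and `∫(1+|x|)^{−2K} dx < ∞` for `2K > 3` (Mathlib
`finite_integral_one_add_norm`). [cite: Rockwell2025NSHodge, Theorem 8.1 (77) p.17] -/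
theorem IsDecayDatum.lintegral_enorm_iteratedFDeriv_sq_lt_top {K : ℝ}
    {u₀ : EuclideanSpace ℝ (Fin 3) → EuclideanSpace ℝ (Fin 3)} (h : IsDecayDatum K u₀) (hK : 3 / 2 < K)
    (n : ℕ) : ∫⁻ x, ‖iteratedFDeriv ℝ n u₀ x‖ₑ ^ 2 < ⊤ := by
  obtain ⟨C, hC⟩ := h.2.2 n
  have hpt : ∀ x : EuclideanSpace ℝ (Fin 3), ‖iteratedFDeriv ℝ n u₀ x‖ₑ ^ 2 ≤
      ENNReal.ofReal (C ^ 2) * ENNReal.ofReal ((1 + ‖x‖) ^ (-(2 * K))) := by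
    intro x
    have hx : 0 < 1 + ‖x‖ := by positivity
    have hxK : 0 < (1 + ‖x‖) ^ K := Real.rpow_pos_of_pos hx K
    have h1 : ‖iteratedFDeriv ℝ n u₀ x‖ ≤ C / (1 + ‖x‖) ^ K := by
      rw [le_div_iff₀ hxK, mul_comm]
      exact hC x
    have h4 : (1 + ‖x‖) ^ (-(2 * K)) = (((1 + ‖x‖) ^ K) ^ 2)⁻¹ := by
      rw [Real.rpow_neg hx.le, ← Real.rpow_natCast ((1 + ‖x‖) ^ K) 2, ← Real.rpow_mul hx.le]
      congr 1
      push_cast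
      ring
    have h2 : ‖iteratedFDeriv ℝ n u₀ x‖ ^ 2 ≤ C ^ 2 * (1 + ‖x‖) ^ (-(2 * K)) := by
      calc ‖iteratedFDeriv ℝ n u₀ x‖ ^ 2 ≤ (C / (1 + ‖x‖) ^ K) ^ 2 :=
            pow_le_pow_left₀ (norm_nonneg _) h1 2
        _ = C ^ 2 * (1 + ‖x‖) ^ (-(2 * K)) := by rw [h4, div_pow, div_eq_mul_inv]
    rw [← ofReal_norm, ← ENNReal.ofReal_pow (norm_nonneg _), ← ENNReal.ofReal_mul (sq_nonneg _)]
    exact ENNReal.ofReal_le_ofReal h2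
  have hr : (Module.finrank ℝ (EuclideanSpace ℝ (Fin 3)) : ℝ) < 2 * K := by
    rw [finrank_euclideanSpace, Fintype.card_fin]
    push_cast
    linarith
  calc ∫⁻ x, ‖iteratedFDeriv ℝ n u₀ x‖ₑ ^ 2
      ≤ ∫⁻ x : EuclideanSpace ℝ (Fin 3),
          ENNReal.ofReal (C ^ 2) * ENNReal.ofReal ((1 + ‖x‖) ^ (-(2 * K))) := lintegral_mono hpt
    _ = ENNReal.ofReal (C ^ 2) * ∫⁻ x : EuclideanSpace ℝ (Fin 3), ENNReal.ofReal ((1 + ‖x‖) ^ (-(2 * K))) :=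
        lintegral_const_mul' _ _ ENNReal.ofReal_ne_top
    _ < ⊤ := ENNReal.mul_lt_top ENNReal.ofReal_lt_top (finite_integral_one_add_norm hr)

/-- **`Step_cont` holds** (the classical wrapper Thm 5.1 pp.7–8 + Cor 7.6 p.17 + Steps 1, 3–6 p.18): for
`ν > 0`, `K > 5` and a (77)-datum `u°`, an integrable majorant `g` on `(0,∞)` of `‖∇u(·,t)‖_∞` along every
classical solution on every slab `[0,T)` from `u°` yields a classical solution on `[0,∞) × ℝ³` from `u°`
with bounded energy. Proof: the datum is `H^∞` (`IsDecayDatum.lintegral_enorm_iteratedFDeriv_sq_lt_top`); by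
the tree's maximal-solution theorem in the BKM class (`exists_global_bkmClass_or_blowup`, Majda–Bertozzi
Thm. 3.6 / BKM 1984) either a global BKM-class solution exists — whose energy is bounded by `∫|u°|²`
(`IsClassicalNSSolutionOn.bkm_energy_le`) — or the maximal solution on `[0,T*)` has
`∫₀^{T*} sup|curl u| = ∞`, impossible under `|curl u| ≤ 4‖∇u‖ ≤ 4g` (`norm_curl_le_four_mul`) with `g`
integrable. [cite: MajdaBertozzi2002, Thm. 3.6 (pp. 115–117), Cor. 3.2 (p. 112), Prop. 3.1] [cite: Rockwell2025NSHodge, Theorem 5.1 pp.7–8; Corollary 7.6 p.17; proof of Theorem 8.1 p.18] -/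
theorem step_cont_holds : Step_cont := by
  intro ν hν K hK u₀ hu₀ hap
  obtain ⟨g, hg, hbound⟩ := hap
  have hH : ∀ n : ℕ, ∫⁻ x, ‖iteratedFDeriv ℝ n u₀ x‖ₑ ^ 2 < ⊤ := fun n =>
    hu₀.lintegral_enorm_iteratedFDeriv_sq_lt_top (by linarith) n
  obtain ⟨hsm, hdiv, -⟩ := hu₀
  rcases exists_global_bkmClass_or_blowup hν.le hsm (fun x => hdiv x) hH with
    ⟨u, p, hu, hu0, hB, -⟩ | ⟨Ts, hTs, u, p, hu, hu0, -, -, -, hbkm, -⟩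
  · refine ⟨u, p, hu, hu0, ?_⟩
    -- bounded energy from the energy inequality in the BKM class (Majda–Bertozzi Prop. 3.1)
    have key : ∀ S : ℝ, 0 < S → ∀ τ ∈ Icc (0:ℝ) S,
        ∫⁻ x, ‖u τ x‖ₑ ^ 2 = ENNReal.ofReal (∫ x, ‖u τ x‖ ^ 2) := by
      intro S hS τ hτ
      have hcl : IsClassicalNSSolutionOn (Icc 0 S) ν 0 u p :=
        hu.mono Icc_subset_Ici_self (uniqueDiffOn_Icc hS)
      obtain ⟨C, hC⟩ := hB S 0
      have hfin0 : ∫⁻ x, ‖iteratedFDeriv ℝ 0 (u τ) x‖ₑ ^ 2 < ⊤ := (hC τ hτ).trans_lt ENNReal.coe_lt_top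
      have heq : (fun x => ‖iteratedFDeriv ℝ 0 (u τ) x‖ₑ ^ 2) = fun x => ‖u τ x‖ₑ ^ 2 := by
        funext x
        rw [← ofReal_norm, norm_iteratedFDeriv_zero, ofReal_norm]
      have hfin : ∫⁻ x, ‖u τ x‖ₑ ^ 2 < ⊤ := by rwa [heq] at hfin0
      have hint : Integrable (fun x => ‖u τ x‖ ^ 2) :=
        integrable_sq_norm_of_lintegral_lt_top (hcl.contDiff_velocity hτ).continuous hfin
      rw [ofReal_integral_eq_lintegral_ofReal hint (Eventually.of_forall fun x => sq_nonneg _)]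
      refine lintegral_congr fun x => ?_
      rw [← ofReal_norm, ENNReal.ofReal_pow (norm_nonneg _)]
    refine ⟨∫⁻ x, ‖u₀ x‖ₑ ^ 2, ?_, fun t ht => ?_⟩
    · have h0 := hH 0
      have heq : (fun x => ‖iteratedFDeriv ℝ 0 u₀ x‖ₑ ^ 2) = fun x => ‖u₀ x‖ₑ ^ 2 := by
        funext x
        rw [← ofReal_norm, norm_iteratedFDeriv_zero, ofReal_norm]
      rwa [heq] at h0
    · have hT : (0:ℝ) < t + 1 := by linarith
      have hcl : IsClassicalNSSolutionOn (Icc 0 (t + 1)) ν 0 u p :=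
        hu.mono Icc_subset_Ici_self (uniqueDiffOn_Icc hT)
      have hE : ∫ x, ‖u t x‖ ^ 2 ≤ ∫ x, ‖u 0 x‖ ^ 2 :=
        hcl.bkm_energy_le hν.le hT (hB (t + 1)) ⟨ht, by linarith⟩
      rw [key (t + 1) hT t ⟨ht, by linarith⟩, ← hu0, key (t + 1) hT 0 ⟨le_rfl, hT.le⟩]
      exact ENNReal.ofReal_le_ofReal hE
  · -- the blow-up branch contradicts the integrable majorant: `|curl u| ≤ 4‖∇u‖ ≤ 4 g`
    exfalso
    have hle : (∫⁻ t in Ioo 0 Ts, ⨆ x, ‖curl (u t) x‖ₑ) ≤ ∫⁻ t in Ioo 0 Ts, ‖4 * g t‖ₑ := by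
      refine setLIntegral_mono' measurableSet_Ioo fun t ht => iSup_le fun x => ?_
      have h1 : ‖curl (u t) x‖ ≤ 4 * g t :=
        (norm_curl_le_four_mul (u t) x).trans
          (mul_le_mul_of_nonneg_left (hbound Ts u p hu hu0 t ⟨ht.1.le, ht.2⟩ x) (by norm_num))
      calc ‖curl (u t) x‖ₑ = ENNReal.ofReal ‖curl (u t) x‖ := (ofReal_norm _).symm
        _ ≤ ENNReal.ofReal (4 * g t) := ENNReal.ofReal_le_ofReal h1
        _ ≤ ‖4 * g t‖ₑ := Real.ofReal_le_enorm _
    have hfin : (∫⁻ t in Ioo 0 Ts, ‖4 * g t‖ₑ) < ⊤ := ((hg.mono_set Ioo_subset_Ioi_self).const_mul 4).2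
    exact (hle.trans_lt hfin).ne hbkm

/-- `Step_cont` — `_holds` alias of `step_cont_holds` above under the fact's exact name (appended
2026-08-28, D-0026 bookkeeping: the proof term is the existing theorem of this file; no statement,
definition or attribute is edited; no new named fact; the ledger's debt table listed the fact
unproved). [cite: Rockwell2025NSHodge, Theorem 5.1 pp.7–8; Corollary 7.6 p.17; proof of Theorem 8.1 p.18] -/
theorem _root_.Literature.Claims.NS.Rockwell2025.Step_cont_holds : Step_cont :=
  _root_.Literature.Claims.NS.Rockwell2025.step_cont_holds

end Literature.Claims.NS.Rockwell2025

end
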